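import Literature.MathematicalPhysics.QuantumFieldTheory.Balaban1983to89.B1Eq27StepAdjoint
import Literature.MathematicalPhysics.QuantumFieldTheory.Balaban1983to89.B1Eq221Coordinates
import Literature.MathematicalPhysics.QuantumFieldTheory.Balaban1983to89.HiggsFluctMeasure

/-!
# `Balaban1983to89.B1Eq230FluctCov` — T. Bałaban, *(Higgs)₂,₃ quantum fields in a finite volume. I. A lower bound*,
Commun. Math. Phys. **85** (1982) 603–626 [Balaban1982Higgs1]: the fluctuation operators `Δ^{(j),L^jε}(Ω,A)` ((2.17)/(2.21))
and covariances `C^{(j),L^jε}(Ω,A)` (2.30) of the CONCRETE model for an ARBITRARY external vector field `A`, region `Ω ⊂ T_ε`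
and coupling `U(A) = exp(qεeA)`; the data of one renormalization step as a `B1RG242.StepData` with EVERY hypothesis of that
abstract module PROVED for the model; and the existence statement of p. 611 (*"It is so"*) for m² > 0

statement-level skeleton of published theorems with citation tags; proofs where landed; nothing here is a claim about the Yang–Mills mass gap

PDF held: `paper:balaban1982-cmp85-higgs23-i` (journal page = PDF page + 602); pp. 604, 608–612 [PDF 2, 6–10] read AS IMAGES
from the ×2 renders `run/shared/lean/pub/pub-balaban/b2b-balaban-ref1/pages/1982-cmp85-higgs23-I/1982-cmp85-higgs23-I-p006…p010-x2.png`.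

CITATION HEADER (lean-in-tree rule) — WHAT IS REPRODUCED.  Cell `lit-balaban` (HOME `run/shared/lean/pub/lit-balaban/`),
Phase-2 proof seat p35 (gen 3), FILE 2 of 3 of the line «B1 (2.41)/(2.42)/(2.43) = B4 (2.34) for the concrete gauge-covariant
operators» (file 1 `B1Eq27StepAdjoint`: the one-step `Q(A)`, `Q^*(A)`; file 3 `B1Eq243HiggsModel`: (2.41)–(2.43)).  SKELETON
rows served (owners r01/r14; no decl of record restated): **B1.Eq2.17** / **B1.Eq2.20** ((2.17), (2.21): `Δ^{(j),L^jε}(Ω,A)`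
for GENERAL `A` — the typer's `HiggsFluctMeasure.deltaK` is the case `A = 0`, `N = d`, `Ω = T`; agreement `deltaKA_zero_field`
PROVED), **B1.Eq2.30** ((2.30): `C^{(j),L^jε}(Ω,A)` for general `A`, `precOpA`/`fluctCovA` — `HiggsFluctMeasure.precOp/fluctCov`
at `A = 0`, `precOpA_zero_field`/`fluctCovA_zero_field` PROVED — and the sentence *"It is not clear from the formulas (2.30),
(2.31) that the covariances are well defined. It is so"*: **`isUnit_precOpA`**, PROVED for m² > 0, a > 0, L > 1, every level
j ≥ 1, every `A`, `Ω`, `C`), and the HYPOTHESES of the abstract `B1RG242.StepData` (QQ^* = 1, adjointness for (1.5),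
positivity, existence of (2.20)/(2.30)) DISCHARGED for the model (`stepData_QQs`, `stepData_scalarProducts`, `stepData_G_arg`,
`stepData_C_arg`) through the matrix dictionary of p34's `B1Eq221Coordinates.fieldCoord` (`mat` = `LinearMap.toMatrix` in
those bases) — `B1RG242` consumed BY NAME (`StepData.isUnit_C_of_next`, `StepData.γ_printed`).
PRINT, verbatim.  p. 610 [PDF 8]: *"We define inductively Δ^{(0),ε}(Ω,A) = −Δ^{ε,N}_{A,Ω} + m², (2.17)"*; *"Defining the
propagator G^ε_k(Ω,A) = (−Δ^{ε,N}_{A,Ω} + m² + a_k(L^kε)^{−2}P_k(A))^{−1}, P_k(A) = Q^*_k(A)Q_k(A), (2.20) and calculating the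
integral in (2.19), we obtain ⟨ψ,Δ^{(k),L^kε}(Ω,A)ψ⟩ = a_k(L^kε)^{−2}⟨ψ,ψ⟩ − a_k²(L^kε)^{−4}⟨ψ,Q_k(A)G^ε_k(Ω,A)Q^*_k(A)ψ⟩. (2.21)"*;
p. 611 [PDF 9]: *"We define a convariance [sic] C^{(k),L^kε}(Ω,A) by means of the quadratic form in φ in this integral:
C^{(k),L^kε}(Ω,A) = (a(L^{k+1}ε)^{−2}P(A) + Δ^{(k),L^kε}(Ω,A))^{−1}. (2.30) … It is not clear from the formulas (2.30), (2.31)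
that the covariances are well defined. It is so, and it is one of the assertions of Proposition 2.3."*; p. 609 [PDF 7]:
*"a_{k+1} = aa_k/(aL^{−2} + a_k). (2.13)"*; p. 604 [PDF 2]: *"The adjoint operators with respect to the scalar product ⟨f,g⟩ =
Σ_{x∈T_ε} ε^d f(x)·g(x) (1.5) can be easily written up."*

WHAT THIS FILE PROVES (0 sorry; axioms ⊆ {propext, Classical.choice, Quot.sound}).
§1 DEFINITIONS with bodies, general `A`, `Ω`, `C`: `deltaKA` (Δ^{(j),L^jε}(Ω,A): (2.17) at j = 0 via `HiggsCovariance.delta0`,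
   the solved form (2.21) for j ≥ 1 — as `B1RG242.StepData.Δk` and `HiggsFluctMeasure.deltaK`), `blockProjA` (the one-step
   P(A) = Q^*(A)Q(A) of (2.30)), `precOpA` (the operator inverted in (2.30)), `fluctCovA` (C^{(j),L^jε}(Ω,A), `Ring.inverse`);
   the `A = 0`, `N = d`, `Ω = T` specialisations to `HiggsFluctMeasure` PROVED (`…_zero_field`).
§2 the matrix DICTIONARY `mat` (products `mat_comp`, `mat_id`, linearity, `mat_inverse` : Ring.inverse ↦ matrix inverse,
   `isUnit_mat_iff`, the scalar products (1.5) `siteInner_eq_dotProduct`, weights `wt`, `adjoint_transfer`).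
§3 `stepData C Ω A msq a j : B1RG242.StepData` (H ↤ Δ^{(0)}, Q_j, Q^*_j, Q, Q^*, α = a_j(L^jε)^{−2}, β = a(L^{j+1}ε)^{−2}) and the
   dictionary lemmas `stepData_Gk` (G^ε_j ↤ `HiggsCovariance.propagatorK`), `stepData_Δk`, `stepData_Ck` (↤ `fluctCovA`),
   `stepData_Qk1`/`stepData_Qk1s` (Q_{j+1} = QQ_j, Q^*_{j+1} = Q^*_jQ^*, from file 1), `stepData_γ` ((2.13)),
   `stepData_next_arg_eq`; the hypotheses AS THEOREMS: `stepData_QQs` (j < K), `stepData_scalarProducts` (m² ≥ 0),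
   `stepData_G_arg`, `stepData_C_arg` (m² > 0, 1 ≤ j), whence **`isUnit_precOpA`**.
HONEST SCOPE.  m² > 0 for the existence statements (for Ω ⊊ T_ε the typer's operators act on all of T_ε, and the massless
operator is then not invertible); levels j < K resp. 1 ≤ j as stated (the tori `Site P j` are meaningful for j ≤ K); nothing
quantitative ((2.33) of Prop. 2.3 is NOT touched — only the qualitative *"It is so"*); the Gaussian dictionary (2.18)/(2.19) →
(2.21) is p34's `B1Eq221*` and is not used.  Value = kernel certificates for the concrete model; NOT summit progress.  Unit
`lit-balaban-p35` gen 3.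
-/

open scoped BigOperators InnerProductSpace Matrix

namespace Literature.MathematicalPhysics.QuantumFieldTheory.Balaban1983to89.B1Eq230FluctCov

open HiggsLattice HiggsAveraging HiggsAveragingCompose HiggsCovariance HiggsCovariancePos B1Eq27StepAdjoint
  B1Eq221Coordinates HiggsFluctMeasure

variable {P : HiggsLattice.Params} {N : ℕ}

/-! ## §1 `Δ^{(j),L^jε}(Ω,A)`, `P(A)`, `C^{(j),L^jε}(Ω,A)` for general `A`, `Ω` ((2.17), (2.21), (2.30)) -/

/-- **`Δ^{(j),L^jε}(Ω,A)`**, by cases on `j` exactly as printed: `j = 0` — (2.17) p. 610 *"Δ^{(0),ε}(Ω,A) = −Δ^{ε,N}_{A,Ω} + m²"*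
(`HiggsCovariance.delta0`); `j ≥ 1` — the solved form (2.21) p. 610, the operator `a_j(L^jε)^{−2}·1 −
a_j²(L^jε)^{−4}·Q_j(A)G^ε_j(Ω,A)Q^*_j(A)` (`HiggsFluctMeasure.coeff221` = a_j(L^jε)^{−2}; general-`A` version of
`HiggsFluctMeasure.deltaK`, same shape as `B1RG242.StepData.Δk`). [cite: Balaban1982Higgs1, (2.21) p.610] -/
noncomputable def deltaKA (C : ChargeData N) (Ω : Finset (HiggsLattice.Site P 0)) (A : HiggsLattice.VecField P 0) (msq a : ℝ) :
    (j : ℕ) → (ScalarField P j N →ₗ[ℝ] ScalarField P j N)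
  | 0 => delta0 C Ω A msq
  | j + 1 => coeff221 P a (j + 1) • LinearMap.id
      - (coeff221 P a (j + 1) ^ 2) •
        (avgQkLin C A (j + 1) ∘ₗ propagatorK C Ω A msq a (j + 1) ∘ₗ avgQkAdj C A (j + 1))

/-- (2.17) at level 0: `Δ^{(0)} = −Δ^{ε,N}_{A,Ω} + m²`. [cite: Balaban1982Higgs1, (2.17) p.610] -/
theorem deltaKA_zero (C : ChargeData N) (Ω : Finset (HiggsLattice.Site P 0)) (A : HiggsLattice.VecField P 0) (msq a : ℝ) :
    deltaKA C Ω A msq a 0 = delta0 C Ω A msq := rfl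

/-- (2.21) at level `j + 1`. [cite: Balaban1982Higgs1, (2.21) p.610] -/
theorem deltaKA_succ (C : ChargeData N) (Ω : Finset (HiggsLattice.Site P 0)) (A : HiggsLattice.VecField P 0) (msq a : ℝ) (j : ℕ) :
    deltaKA C Ω A msq a (j + 1) = coeff221 P a (j + 1) • LinearMap.id
      - (coeff221 P a (j + 1) ^ 2) •
        (avgQkLin C A (j + 1) ∘ₗ propagatorK C Ω A msq a (j + 1) ∘ₗ avgQkAdj C A (j + 1)) := rfl

/-- **`P(A) = Q^*(A)Q(A)`**, the ONE-step operator of (2.30) at level `j` ((2.20) for one step; the one-step operators of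
`B1Eq27StepAdjoint`). [cite: Balaban1982Higgs1, (2.30) p.611] -/
noncomputable def blockProjA (C : ChargeData N) (A : HiggsLattice.VecField P 0) (j : ℕ) : ScalarField P j N →ₗ[ℝ] ScalarField P j N :=
  avgQAdjLin C A j ∘ₗ avgQLin C A j

/-- **The operator inverted in (2.30)**: `a(L^{j+1}ε)^{−2}P(A) + Δ^{(j),L^jε}(Ω,A)`. [cite: Balaban1982Higgs1, (2.30) p.611] -/
noncomputable def precOpA (C : ChargeData N) (Ω : Finset (HiggsLattice.Site P 0)) (A : HiggsLattice.VecField P 0) (msq a : ℝ) (j : ℕ) :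
    ScalarField P j N →ₗ[ℝ] ScalarField P j N :=
  (a * ((P.mesh (j + 1))⁻¹ ^ 2)) • blockProjA C A j + deltaKA C Ω A msq a j

/-- **(2.30)** p. 611: `C^{(j),L^jε}(Ω,A) = (a(L^{j+1}ε)^{−2}P(A) + Δ^{(j),L^jε}(Ω,A))^{−1}` — as the inverse in the endomorphism
ring (`Ring.inverse`, junk `0` when not invertible; invertibility is the THEOREM `isUnit_precOpA` below, the paper's *"It is
so"*). [cite: Balaban1982Higgs1, (2.30) p.611] -/
noncomputable def fluctCovA (C : ChargeData N) (Ω : Finset (HiggsLattice.Site P 0)) (A : HiggsLattice.VecField P 0) (msq a : ℝ) (j : ℕ) :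
    Module.End ℝ (ScalarField P j N) :=
  Ring.inverse (precOpA C Ω A msq a j : Module.End ℝ (ScalarField P j N))

/-! ### The case `A = 0`, `N = d`, `Ω = T` IS the typer's `HiggsFluctMeasure` (no twin: specialisation proved) -/

/-- `Δ^{(j)}` at zero field / trivial coupling / whole torus is `HiggsFluctMeasure.deltaK` (definitional).
[cite: Balaban1982Higgs1, (2.21) p.610] -/
theorem deltaKA_zero_field (msq a : ℝ) (j : ℕ) :
    deltaKA (B3MultiscaleFields.zeroCharge P.d) Finset.univ (0 : HiggsLattice.VecField P 0) msq a j = HiggsFluctMeasure.deltaK P msq a j := by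
  cases j with
  | zero => rfl
  | succ j => rfl

/-- The one-step `P(0)` is the HiggsLattice.block mean `HiggsFluctMeasure.blockMean` (`U(0) = 1`). [cite: Balaban1982Higgs1, (2.30) p.611] -/
theorem blockProjA_zero_field (j : ℕ) :
    blockProjA (B3MultiscaleFields.zeroCharge P.d) (0 : HiggsLattice.VecField P 0) j = blockMean P j := by
  refine LinearMap.ext fun f => funext fun x => ?_
  rw [blockProjA, LinearMap.comp_apply, avgQAdjLin_apply, blockMean_eq_avgQ, avgQLin_apply,
    B3MultiscaleFields.zeroCharge_U, star_one, one_apply_eq_self]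

/-- The operator of (2.30) at zero field is `HiggsFluctMeasure.precOp`. [cite: Balaban1982Higgs1, (2.30) p.611] -/
theorem precOpA_zero_field (msq a : ℝ) (j : ℕ) :
    precOpA (B3MultiscaleFields.zeroCharge P.d) Finset.univ (0 : HiggsLattice.VecField P 0) msq a j = precOp P msq a j := by
  rw [precOpA, blockProjA_zero_field, deltaKA_zero_field, precOp_eq]

/-- `C^{(j)}` at zero field is `HiggsFluctMeasure.fluctCov`. [cite: Balaban1982Higgs1, (2.30) p.611] -/
theorem fluctCovA_zero_field (msq a : ℝ) (j : ℕ) :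
    fluctCovA (B3MultiscaleFields.zeroCharge P.d) Finset.univ (0 : HiggsLattice.VecField P 0) msq a j = fluctCov P msq a j := by
  rw [fluctCovA, precOpA_zero_field]; rfl

/-! ## §2 The matrix dictionary: `LinearMap.toMatrix` in the integration coordinates `B1Eq221Coordinates.fieldCoord` -/

section Dictionary

/-- The internal index of one site value `ℝ^N` in the coordinates of `B1Eq221Coordinates`. [cite: Balaban1982Higgs1, (1.5) p.604] -/
abbrev Ix (N : ℕ) : Type := Idx (E N)

/-- The coordinate basis of the fields on `T^{(j)}` (`Module.Basis.ofEquivFun` of p34's `fieldCoord`). [cite: Balaban1982Higgs1, (1.5) p.604] -/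
noncomputable def cb (P : HiggsLattice.Params) (N j : ℕ) : Module.Basis (HiggsLattice.Site P j × Ix N) ℝ (ScalarField P j N) :=
  Module.Basis.ofEquivFun (fieldCoord (E N) (HiggsLattice.Site P j))

/-- The matrix of a linear map between field spaces in the coordinate bases. [cite: Balaban1982Higgs1, (1.5) p.604] -/
noncomputable def mat {i j : ℕ} (f : ScalarField P i N →ₗ[ℝ] ScalarField P j N) :
    Matrix (HiggsLattice.Site P j × Ix N) (HiggsLattice.Site P i × Ix N) ℝ :=
  LinearMap.toMatrix (cb P N i) (cb P N j) f

/-- Coordinates: `(cb).repr f = fieldCoord f`. [cite: Balaban1982Higgs1, (1.5) p.604] -/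
theorem cb_repr {j : ℕ} (f : ScalarField P j N) : ⇑((cb P N j).repr f) = fieldCoord (E N) (HiggsLattice.Site P j) f :=
  funext fun i => Module.Basis.ofEquivFun_repr_apply _ f i

/-- `mat f` acts on coordinates as `f`. [cite: Balaban1982Higgs1, (1.5) p.604] -/
theorem mat_mulVec {i j : ℕ} (f : ScalarField P i N →ₗ[ℝ] ScalarField P j N) (φ : ScalarField P i N) :
    mat f *ᵥ fieldCoord (E N) (HiggsLattice.Site P i) φ = fieldCoord (E N) (HiggsLattice.Site P j) (f φ) := by
  rw [← cb_repr, ← cb_repr, mat, LinearMap.toMatrix_mulVec_repr]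

/-- `mat` is multiplicative. [cite: Balaban1982Higgs1, (1.5) p.604] -/
theorem mat_comp {i j l : ℕ} (f : ScalarField P j N →ₗ[ℝ] ScalarField P l N) (g : ScalarField P i N →ₗ[ℝ] ScalarField P j N) :
    mat (f ∘ₗ g) = mat f * mat g :=
  LinearMap.toMatrix_comp (cb P N i) (cb P N j) (cb P N l) f g

/-- `mat id = 1`. [cite: Balaban1982Higgs1, (1.5) p.604] -/
theorem mat_id {j : ℕ} : mat (LinearMap.id : ScalarField P j N →ₗ[ℝ] ScalarField P j N) = 1 :=
  LinearMap.toMatrix_id (cb P N j)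

/-- `mat` is additive. [cite: Balaban1982Higgs1, (1.5) p.604] -/
theorem mat_add {i j : ℕ} (f g : ScalarField P i N →ₗ[ℝ] ScalarField P j N) : mat (f + g) = mat f + mat g :=
  map_add _ f g

/-- `mat` commutes with subtraction. [cite: Balaban1982Higgs1, (1.5) p.604] -/
theorem mat_sub {i j : ℕ} (f g : ScalarField P i N →ₗ[ℝ] ScalarField P j N) : mat (f - g) = mat f - mat g :=
  map_sub _ f g

/-- `mat` is homogeneous. [cite: Balaban1982Higgs1, (1.5) p.604] -/
theorem mat_smul {i j : ℕ} (c : ℝ) (f : ScalarField P i N →ₗ[ℝ] ScalarField P j N) : mat (c • f) = c • mat f :=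
  map_smul _ c f

/-- `mat 0 = 0`. [cite: Balaban1982Higgs1, (1.5) p.604] -/
theorem mat_zero {i j : ℕ} : mat (0 : ScalarField P i N →ₗ[ℝ] ScalarField P j N) = 0 :=
  map_zero (LinearMap.toMatrix (cb P N i) (cb P N j))

/-- `mat` is injective. [cite: Balaban1982Higgs1, (1.5) p.604] -/
theorem mat_injective {i j : ℕ} : Function.Injective (mat : (ScalarField P i N →ₗ[ℝ] ScalarField P j N) → _) :=
  (LinearMap.toMatrix (cb P N i) (cb P N j)).injective

/-- On endomorphisms `mat` is the algebra equivalence `LinearMap.toMatrixAlgEquiv`. [cite: Balaban1982Higgs1, (1.5) p.604] -/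
theorem mat_eq_algEquiv {j : ℕ} (f : Module.End ℝ (ScalarField P j N)) :
    mat f = LinearMap.toMatrixAlgEquiv (cb P N j) f := rfl

/-- Units correspond: `mat f` is invertible iff `f` is. [cite: Balaban1982Higgs1, (1.5) p.604] -/
theorem isUnit_mat_iff {j : ℕ} (f : Module.End ℝ (ScalarField P j N)) : IsUnit (mat f) ↔ IsUnit f := by
  rw [mat_eq_algEquiv]
  exact isUnit_map_iff (LinearMap.toMatrixAlgEquiv (cb P N j)) f

/-- `mat` takes `Ring.inverse` to the matrix inverse. [cite: Balaban1982Higgs1, (1.5) p.604] -/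
theorem mat_inverse {j : ℕ} (f : Module.End ℝ (ScalarField P j N)) : mat (Ring.inverse f) = (mat f)⁻¹ := by
  by_cases hf : IsUnit f
  · obtain ⟨u, rfl⟩ := hf
    rw [Ring.inverse_unit]
    have h1 : mat (↑u⁻¹ : Module.End ℝ (ScalarField P j N)) * mat (↑u : Module.End ℝ (ScalarField P j N)) = 1 := by
      rw [← mat_comp, ← Module.End.mul_eq_comp, Units.inv_mul, Module.End.one_eq_id, mat_id]
    exact (Matrix.inv_eq_left_inv h1).symm
  · have hm : ¬IsUnit (mat f) := fun h => hf ((isUnit_mat_iff f).mp h)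
    rw [Ring.inverse_non_unit _ hf, mat_zero, Matrix.nonsing_inv_eq_ringInverse, Ring.inverse_non_unit _ hm]

/-- The scalar product (1.5) in coordinates: `⟨f, g⟩_{T^{(j)}} = (L^jε)^d · (fieldCoord f ⬝ᵥ fieldCoord g)`.
[cite: Balaban1982Higgs1, (1.5) p.604] -/
theorem siteInner_eq_dotProduct {j : ℕ} (f g : ScalarField P j N) :
    siteInner f g = P.mesh j ^ P.d * (fieldCoord (E N) (HiggsLattice.Site P j) f ⬝ᵥ fieldCoord (E N) (HiggsLattice.Site P j) g) := by
  rw [← sum_inner_eq_dotProduct, siteInner, Finset.mul_sum]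

/-- The weight matrix of (1.5) on `T^{(j)}`: `(L^jε)^d · 1`. [cite: Balaban1982Higgs1, (1.5) p.604] -/
noncomputable def wt (P : HiggsLattice.Params) (N j : ℕ) : Matrix (HiggsLattice.Site P j × Ix N) (HiggsLattice.Site P j × Ix N) ℝ :=
  (P.mesh j ^ P.d) • (1 : Matrix (HiggsLattice.Site P j × Ix N) (HiggsLattice.Site P j × Ix N) ℝ)

/-- `u ⬝ᵥ (wt *ᵥ v) = (L^jε)^d (u ⬝ᵥ v)`. [cite: Balaban1982Higgs1, (1.5) p.604] -/
theorem dotProduct_wt_mulVec {j : ℕ} (u v : HiggsLattice.Site P j × Ix N → ℝ) :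
    u ⬝ᵥ (wt P N j *ᵥ v) = P.mesh j ^ P.d * (u ⬝ᵥ v) := by
  rw [wt, Matrix.smul_mulVec, Matrix.one_mulVec, dotProduct_smul, smul_eq_mul]

/-- The weights are positive definite. [cite: Balaban1982Higgs1, (1.5) p.604] -/
theorem wt_pos {j : ℕ} (u : HiggsLattice.Site P j × Ix N → ℝ) (hu : u ≠ 0) : 0 < u ⬝ᵥ (wt P N j *ᵥ u) := by
  rw [dotProduct_wt_mulVec]
  refine mul_pos (pow_pos (P.mesh_pos j) _) (lt_of_le_of_ne (Finset.sum_nonneg fun x _ => mul_self_nonneg (u x)) ?_)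
  exact fun h0 => hu (dotProduct_self_eq_zero.mp h0.symm)

/-- An adjointness for the scalar products (1.5) transfers to the coordinate matrices. [cite: Balaban1982Higgs1, (1.5) p.604] -/
theorem adjoint_transfer {i j : ℕ} {X : ScalarField P i N →ₗ[ℝ] ScalarField P j N}
    {Xs : ScalarField P j N →ₗ[ℝ] ScalarField P i N} (h : ∀ f g, siteInner (X f) g = siteInner f (Xs g))
    (φ : HiggsLattice.Site P i × Ix N → ℝ) (ψ : HiggsLattice.Site P j × Ix N → ℝ) :
    φ ⬝ᵥ (wt P N i *ᵥ (mat Xs *ᵥ ψ)) = (mat X *ᵥ φ) ⬝ᵥ (wt P N j *ᵥ ψ) := by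
  obtain ⟨f, rfl⟩ : ∃ f, φ = fieldCoord (E N) (HiggsLattice.Site P i) f :=
    ⟨(fieldCoord (E N) (HiggsLattice.Site P i)).symm φ, ((fieldCoord (E N) (HiggsLattice.Site P i)).apply_symm_apply φ).symm⟩
  obtain ⟨g, rfl⟩ : ∃ g, ψ = fieldCoord (E N) (HiggsLattice.Site P j) g :=
    ⟨(fieldCoord (E N) (HiggsLattice.Site P j)).symm ψ, ((fieldCoord (E N) (HiggsLattice.Site P j)).apply_symm_apply ψ).symm⟩
  rw [mat_mulVec, mat_mulVec, dotProduct_wt_mulVec, dotProduct_wt_mulVec, ← siteInner_eq_dotProduct,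
    ← siteInner_eq_dotProduct, h]

end Dictionary

/-! ## §3 The `B1RG242.StepData` of the model at level `j` and its hypotheses as theorems -/

section Step

variable (C : ChargeData N) (Ω : Finset (HiggsLattice.Site P 0)) (A : HiggsLattice.VecField P 0) (msq a : ℝ)

/-- THE STEP DATA of level `j` of the concrete model (B1 §2 dictionary of `B1RG242.StepData`): H ↤ Δ^{(0),ε}(Ω,A) = −Δ^{ε,N}_{A,Ω}
+ m² (`HiggsCovariance.delta0`), Q_j(A), Q^*_j(A) ↤ `HiggsCovariance.avgQkLin/avgQkAdj`, Q(A), Q^*(A) at level j ↤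
`B1Eq27StepAdjoint.avgQLin/avgQAdjLin`, α ↤ a_j(L^jε)^{−2}, β ↤ a(L^{j+1}ε)^{−2}, all as matrices in the coordinate bases.
[cite: Balaban1982Higgs1, (2.20) p.610, (2.30) p.611] -/
noncomputable def stepData (j : ℕ) :
    B1RG242.StepData ℝ (HiggsLattice.Site P 0 × Ix N) (HiggsLattice.Site P j × Ix N) (HiggsLattice.Site P (j + 1) × Ix N) where
  H := mat (delta0 C Ω A msq)
  Qk := mat (avgQkLin C A j)
  Qks := mat (avgQkAdj C A j)
  Q := mat (avgQLin C A j)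
  Qs := mat (avgQAdjLin C A j)
  α := coeff221 P a j
  β := a * ((P.mesh (j + 1))⁻¹ ^ 2)

/-- `QQ^* = 1` for the step data (`B1Eq27StepAdjoint.avgQLin_comp_avgQAdjLin`), j < K. [cite: Balaban1982Higgs1, (2.7) p.608] -/
theorem stepData_QQs {j : ℕ} (hj : j < P.K) : (stepData C Ω A msq a j).Q * (stepData C Ω A msq a j).Qs = 1 := by
  show mat (avgQLin C A j) * mat (avgQAdjLin C A j) = 1
  rw [← mat_comp, avgQLin_comp_avgQAdjLin hj, mat_id]

/-- The argument of G^ε_j: `H + αP_j` IS the matrix of the typer's `covOpK` (2.20). [cite: Balaban1982Higgs1, (2.20) p.610] -/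
theorem stepData_G_arg_eq (j : ℕ) :
    (stepData C Ω A msq a j).H + (stepData C Ω A msq a j).α • (stepData C Ω A msq a j).Pk = mat (covOpK C Ω A msq a j) := by
  show mat (delta0 C Ω A msq) + coeff221 P a j • (mat (avgQkAdj C A j) * mat (avgQkLin C A j)) = _
  rw [← mat_comp, ← mat_smul, ← mat_add]
  rfl

/-- `G^ε_j` of the step data IS the matrix of the typer's `propagatorK` (2.20). [cite: Balaban1982Higgs1, (2.20) p.610] -/
theorem stepData_Gk (j : ℕ) : (stepData C Ω A msq a j).Gk = mat (propagatorK C Ω A msq a j) := by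
  rw [B1RG242.StepData.Gk, stepData_G_arg_eq, propagatorK, mat_inverse]

/-- `Δ^{(j)}` of the step data IS the matrix of `deltaKA` for j ≥ 1 ((2.21)). [cite: Balaban1982Higgs1, (2.21) p.610] -/
theorem stepData_Δk (j : ℕ) : (stepData C Ω A msq a (j + 1)).Δk = mat (deltaKA C Ω A msq a (j + 1)) := by
  rw [B1RG242.StepData.Δk, stepData_Gk, deltaKA_succ, mat_sub, mat_smul, mat_smul, mat_id, mat_comp, mat_comp,
    Matrix.mul_assoc]
  rfl

/-- The argument of `C^{(j)}`: `βP + Δ^{(j)}` IS the matrix of `precOpA` (2.30), j ≥ 1. [cite: Balaban1982Higgs1, (2.30) p.611] -/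
theorem stepData_C_arg_eq (j : ℕ) :
    (stepData C Ω A msq a (j + 1)).β • (stepData C Ω A msq a (j + 1)).P + (stepData C Ω A msq a (j + 1)).Δk
      = mat (precOpA C Ω A msq a (j + 1)) := by
  rw [stepData_Δk, precOpA, blockProjA, mat_add, mat_smul, mat_comp]
  rfl

/-- `C^{(j)}` of the step data IS the matrix of `fluctCovA` (2.30), j ≥ 1. [cite: Balaban1982Higgs1, (2.30) p.611] -/
theorem stepData_Ck (j : ℕ) : (stepData C Ω A msq a (j + 1)).Ck = mat (fluctCovA C Ω A msq a (j + 1)) := by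
  rw [B1RG242.StepData.Ck, stepData_C_arg_eq, fluctCovA, mat_inverse]

/-- `Q_{j+1} = QQ_j` for the step data (`B1Eq27StepAdjoint.avgQLin_comp_avgQkLin`). [cite: Balaban1982Higgs1, (2.14) p.609] -/
theorem stepData_Qk1 (j : ℕ) : (stepData C Ω A msq a j).Qk1 = mat (avgQkLin C A (j + 1)) := by
  show mat (avgQLin C A j) * mat (avgQkLin C A j) = _
  rw [← mat_comp, avgQLin_comp_avgQkLin]

/-- `Q^*_{j+1} = Q^*_jQ^*` for the step data (`B1Eq27StepAdjoint.avgQkAdj_succ`). [cite: Balaban1982Higgs1, (2.2) p.608] -/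
theorem stepData_Qk1s (j : ℕ) : (stepData C Ω A msq a j).Qk1s = mat (avgQkAdj C A (j + 1)) := by
  show mat (avgQkAdj C A j) * mat (avgQAdjLin C A j) = _
  rw [← mat_comp, avgQkAdj_succ]

/-- `γ = a_{j+1}(L^{j+1}ε)^{−2}` for the step data ((2.13), `B1RG242.StepData.γ_printed`), a > 0, L > 1, j ≥ 1.
[cite: Balaban1982Higgs1, (2.13) p.609] -/
theorem stepData_γ {a : ℝ} (ha : 0 < a) (hL : 1 < (P.L : ℝ)) {j : ℕ} (hj : 1 ≤ j) :
    (stepData C Ω A msq a j).γ = coeff221 P a (j + 1) := by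
  have hmesh : P.mesh (j + 1) = P.L * P.mesh j := by unfold HiggsLattice.Params.mesh; rw [pow_succ]; ring
  rw [B1RG242.StepData.γ_printed (stepData C Ω A msq a j) ha hL hj (P.mesh_pos j)
      (show (stepData C Ω A msq a j).α = B1.aSeq a P.L j * (P.mesh j ^ 2)⁻¹ by
        show coeff221 P a j = _; rw [coeff221_eq, inv_pow])
      (show (stepData C Ω A msq a j).β = a * ((P.L * P.mesh j) ^ 2)⁻¹ by
        show a * ((P.mesh (j + 1))⁻¹ ^ 2) = _; rw [inv_pow, hmesh]),
    coeff221_eq, inv_pow, hmesh]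

/-- The argument of `G^ε_{j+1}` built from the step data IS the matrix of `covOpK` at level j + 1. [cite: Balaban1982Higgs1, (2.20) p.610] -/
theorem stepData_next_arg_eq {a : ℝ} (ha : 0 < a) (hL : 1 < (P.L : ℝ)) {j : ℕ} (hj : 1 ≤ j) :
    (stepData C Ω A msq a j).H + (stepData C Ω A msq a j).γ • (stepData C Ω A msq a j).Pk1
      = mat (covOpK C Ω A msq a (j + 1)) := by
  rw [B1RG242.StepData.Pk1, stepData_Qk1, stepData_Qk1s, stepData_γ C Ω A msq ha hL hj, ← mat_comp, ← mat_smul]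
  show mat (delta0 C Ω A msq) + _ = _
  rw [← mat_add]
  rfl

/-- THE SCALAR PRODUCTS (1.5) for the step data: positivity of the weights, `⟨φ, (−Δ^{ε,N}_{A,Ω} + m²)φ⟩ ≥ 0` (m² ≥ 0,
`HiggsCovariancePos.siteInner_covLaplacianN_nonneg`), Q^*_j resp. Q^* ARE the adjoints
(`HiggsCovariancePos.siteInner_avgQkLin`, `B1Eq27StepAdjoint.siteInner_avgQLin`), α, β > 0 (a > 0, L > 1, j ≥ 1:
`B1.aSeq_pos`) — `B1RG242.StepData.ScalarProducts` HOLDS. [cite: Balaban1982Higgs1, (1.5) p.604] -/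
theorem stepData_scalarProducts {msq a : ℝ} (hm : 0 ≤ msq) (ha : 0 < a) (hL : 1 < (P.L : ℝ)) {j : ℕ} (hj : 1 ≤ j) :
    (stepData C Ω A msq a j).ScalarProducts (wt P N 0) (wt P N j) (wt P N (j + 1)) where
  posK u hu := wt_pos u hu
  posM v hv := wt_pos v hv
  formH φ := by
    obtain ⟨f, rfl⟩ : ∃ f, φ = fieldCoord (E N) (HiggsLattice.Site P 0) f :=
      ⟨(fieldCoord (E N) (HiggsLattice.Site P 0)).symm φ, ((fieldCoord (E N) (HiggsLattice.Site P 0)).apply_symm_apply φ).symm⟩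
    show 0 ≤ fieldCoord (E N) (HiggsLattice.Site P 0) f ⬝ᵥ (wt P N 0 *ᵥ (mat (delta0 C Ω A msq) *ᵥ fieldCoord (E N) (HiggsLattice.Site P 0) f))
    rw [mat_mulVec, dotProduct_wt_mulVec, ← siteInner_eq_dotProduct, delta0, LinearMap.add_apply,
      LinearMap.smul_apply, LinearMap.id_apply]
    have hsplit : siteInner f (covLaplacianN C Ω A f + msq • f) = siteInner f (covLaplacianN C Ω A f) + msq * siteInner f f := by
      unfold siteInner
      simp only [Pi.add_apply, Pi.smul_apply, inner_add_right, real_inner_smul_right, mul_add, Finset.sum_add_distrib,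
        Finset.mul_sum]
      exact congrArg _ (Finset.sum_congr rfl fun x _ => by ring)
    rw [hsplit]
    exact add_nonneg (siteInner_covLaplacianN_nonneg C Ω A f) (mul_nonneg hm (siteInner_self_nonneg f))
  adjk φ ψ := adjoint_transfer (fun f g => siteInner_avgQkLin C A j f g) φ ψ
  adj ψ θ := adjoint_transfer (fun f g => siteInner_avgQLin C A j f g) ψ θ
  α_pos := by
    show 0 < coeff221 P a j
    rw [coeff221_eq]
    exact mul_pos (B1.aSeq_pos ha hL hj) (pow_pos (inv_pos.mpr (P.mesh_pos j)) 2)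
  β_pos := by
    show 0 < a * ((P.mesh (j + 1))⁻¹ ^ 2)
    exact mul_pos ha (pow_pos (inv_pos.mpr (P.mesh_pos (j + 1))) 2)

/-- EXISTENCE of `G^ε_j`: the argument of (2.20) is invertible for the step data (m² > 0; `HiggsCovariancePos.isUnit_covOpK_of_pos`).
[cite: Balaban1982Higgs1, (2.20) p.610] -/
theorem stepData_G_arg {msq a : ℝ} (hm : 0 < msq) (ha : 0 < a) (hL : 1 < (P.L : ℝ)) {j : ℕ} (hj : 1 ≤ j) :
    IsUnit ((stepData C Ω A msq a j).H + (stepData C Ω A msq a j).α • (stepData C Ω A msq a j).Pk) := by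
  rw [stepData_G_arg_eq, isUnit_mat_iff]
  exact isUnit_covOpK_of_pos C Ω A hm ha hL hj

/-- EXISTENCE of `C^{(j),L^jε}` for the step data: the argument of (2.30) is invertible (m² > 0, 1 ≤ j), by
`B1RG242.StepData.isUnit_C_of_next` from the existence of `G^ε_{j+1}`. [cite: Balaban1982Higgs1, (2.30) p.611] -/
theorem stepData_C_arg {msq a : ℝ} (hm : 0 < msq) (ha : 0 < a) (hL : 1 < (P.L : ℝ)) {j : ℕ} (hj : 1 ≤ j) :
    IsUnit ((stepData C Ω A msq a j).β • (stepData C Ω A msq a j).P + (stepData C Ω A msq a j).Δk) := by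
  refine B1RG242.StepData.isUnit_C_of_next (stepData_scalarProducts C Ω A hm.le ha hL hj) ?_
  rw [stepData_next_arg_eq C Ω A msq ha hL hj, isUnit_mat_iff]
  exact isUnit_covOpK_of_pos C Ω A hm ha hL (by omega)

/-- **"It is so" (p. 611) for the concrete model**: the operator `a(L^{j+1}ε)^{−2}P(A) + Δ^{(j),L^jε}(Ω,A)` inverted in (2.30)
IS invertible, for m² > 0, a > 0, L > 1 and every level 1 ≤ j — so `fluctCovA` is a genuine two-sided inverse there.
[cite: Balaban1982Higgs1, (2.30) p.611] -/
theorem isUnit_precOpA {msq a : ℝ} (hm : 0 < msq) (ha : 0 < a) (hL : 1 < (P.L : ℝ)) {j : ℕ} (hj : 1 ≤ j) :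
    IsUnit (precOpA C Ω A msq a j : Module.End ℝ (ScalarField P j N)) := by
  obtain ⟨j, rfl⟩ : ∃ j', j = j' + 1 := ⟨j - 1, by omega⟩
  rw [← isUnit_mat_iff, ← stepData_C_arg_eq]
  exact stepData_C_arg C Ω A hm ha hL hj

end Step

end Literature.MathematicalPhysics.QuantumFieldTheory.Balaban1983to89.B1Eq230FluctCov
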